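import Mathlib
import HarnessLib

/-!
# Ordered products of `{0,1}ᵏ`-indexed matrix families in the little-endian binary order
# (the induction vehicle `∏_{b ∈ {0,1}^d} M_b(x_b)` of Forbes–Shpilka 2013, §3)

M. A. Forbes, A. Shpilka, *Quasipolynomial-time identity testing of non-commutative and read-once
oblivious algebraic branching programs*, FOCS 2013 = arXiv:1209.2408 [ForbesShpilka2013], §3
(paper:arxiv-1209.2408 p0013.txt:L16–L19: "instead of talking about such ABPs, we will be discussing
products of matrices `∏_i M_i(x_i)` … For induction purposes … we will consider the full matrices",
and Lemma 19 p0016.txt:L22–L40: "`𝒮 := span{∏_{b ∈ {0,1}^d} M_b(x_b)}` … It follows from definition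
that `𝒮 = 𝒮_0 · 𝒮_1`"). This file supplies the bookkeeping behind that sentence for the cell's
`N = 2ⁿ`-variate roABPs in the binary variable order (`binaryOrder n = finFunctionFinEquiv.symm ∘ …`,
`FSV2018ROABP.lean`):

* `FS2013.bprod k M` — the ordered product of a family `M : (Fin k → Fin 2) → A` in the little-endian
  binary order of the bit vectors, DEFINED by the recursion on the top bit
  `bprod (k+1) M = bprod k (M ∘ (snoc · 0)) * bprod k (M ∘ (snoc · 1))` ("`𝒮 = 𝒮_0 · 𝒮_1`");
* `FS2013.map_bprod` — multiplicative maps (e.g. `Matrix.map` of a ring hom, evaluation) commute with it;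
* `FS2013.natDegree_bprod_le` — entries of a `2ᵏ`-fold product of `w × w` matrices of univariate
  polynomials of degree `≤ D` have degree `≤ 2ᵏ·D` (the count "`R ∈ 𝔽[x]^{r×r}` is of degree `< Dnm`"
  of Lemma 3.6 / arXiv Lemma 12, p0014.txt:L29);
* `FS2013.prod_ofFn_finFunctionFinEquiv_symm` — the bridge to the cell's roABP form:
  `(List.ofFn fun j : Fin (2^k) => M (finFunctionFinEquiv.symm j)).prod = bprod k M`, i.e. the ordered
  layer product of `IsROABP … (binaryOrder n) …` IS `bprod` (the index `j = Σ_i b_i 2^i` splits as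
  `j < 2^k ↔ b_k = 0`).

Pure algebra; no named facts; nothing here bears on `VP ≠ VNP`. Written for the discharge of
`ForbesShpilkaVolk2018_lemma55` (FSV 2018 Lemma 55 = [FS13] Construction 3.13 / arXiv Constr. 15).

## References
* [ForbesShpilka2013] arXiv:1209.2408 §3, §3.2 (locator: paper:arxiv-1209.2408 p0013.txt:L16–L19,
  p0016.txt:L22–L40).
* [ForbesShpilkaVolk2018] §7, Lemma 55 (seq.; = ToC Lemma 7.1) — the consumer (`FSV2018ROABP.lean`).
-/

noncomputable section

namespace Literature.Computability.AlgebraicComplexity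

namespace FS2013

open Polynomial Matrix Finset

open scoped BigOperators Pointwise

/-! ### The ordered product over `{0,1}ᵏ` -/

/-- **The ordered product `∏_{b ∈ {0,1}ᵏ} M_b` in the little-endian binary order of the bit vectors**
(`b ↦ Σ_i b_i 2^i`), defined by the recursion on the TOP bit: the empty bit vector gives `M_∅`, and
`∏_{b ∈ {0,1}^{k+1}} M_b = (∏_{b' ∈ {0,1}^k} M_{b'0}) · (∏_{b' ∈ {0,1}^k} M_{b'1})` — "It follows from
definition that `𝒮 = 𝒮_0 · 𝒮_1`" (the two variable-disjoint halves of the read-once product).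
[cite: ForbesShpilka2013, Lemma 3.? = arXiv Lemma 19, proof ("`𝒮 = 𝒮_0 · 𝒮_1`")]
locator: paper:arxiv-1209.2408 p0016.txt:L30–L40 -/
def bprod {A : Type*} [Mul A] : (k : ℕ) → ((Fin k → Fin 2) → A) → A
  | 0, M => M fun i => i.elim0
  | k + 1, M => bprod k (fun b => M (Fin.snoc b 0)) * bprod k (fun b => M (Fin.snoc b 1))

variable {A B : Type*}

/-- Unfolding at `k = 0`: the product over the single empty bit vector.
[cite: ForbesShpilka2013, arXiv Lemma 19, proof, case `d = 0` ("`{0,1}^0 = {ε}`")]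
locator: paper:arxiv-1209.2408 p0016.txt:L26–L28 -/
@[simp] theorem bprod_zero [Mul A] (M : (Fin 0 → Fin 2) → A) :
    bprod 0 M = M fun i => i.elim0 := rfl

/-- Unfolding at `k + 1`: `∏_{b ∈ {0,1}^{k+1}} M_b = (∏_{b'} M_{b'0}) · (∏_{b'} M_{b'1})`.
[cite: ForbesShpilka2013, arXiv Lemma 19, proof ("`𝒮 = 𝒮_0 · 𝒮_1`")] locator: paper:arxiv-1209.2408 p0016.txt:L37 -/
theorem bprod_succ [Mul A] (k : ℕ) (M : (Fin (k + 1) → Fin 2) → A) :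
    bprod (k + 1) M =
      bprod k (fun b => M (Fin.snoc b 0)) * bprod k (fun b => M (Fin.snoc b 1)) := rfl

/-- The family over `Fin 0` has a single member ("for `d = 0`, `{0,1}^0 = {ε}`").
[cite: ForbesShpilka2013, arXiv Lemma 19, proof, case `d = 0`] locator: paper:arxiv-1209.2408 p0016.txt:L26 -/
theorem eq_elim0 (b : Fin 0 → Fin 2) : b = fun i => i.elim0 := funext fun i => i.elim0

/-- Congruence: the ordered product `∏_b M_b` only depends on the values `M_b`.
[cite: ForbesShpilka2013, arXiv Lemma 19, proof ("`𝒮 = 𝒮_0 · 𝒮_1`", bookkeeping)] locator: paper:arxiv-1209.2408 p0016.txt:L37 -/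
theorem bprod_congr [Mul A] {k : ℕ} {M N : (Fin k → Fin 2) → A} (h : ∀ b, M b = N b) :
    bprod k M = bprod k N := by
  rw [show M = N from funext h]

/-- Multiplicative maps commute with the ordered product `∏_b M_b` (evaluation of the matrix form
"`f(x) = (∏_i M_i(x_i))_{(0,0)}`" layer by layer, and base change).
[cite: ForbesShpilka2013, Lemma 3.1 = arXiv Lemma 6 (matrix form, evaluated layer-wise)] locator: paper:arxiv-1209.2408 p0013.txt:L5–L16 -/
theorem map_bprod [Mul A] [Mul B] {F : Type*} [FunLike F A B] [MulHomClass F A B] (f : F) :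
    ∀ (k : ℕ) (M : (Fin k → Fin 2) → A), f (bprod k M) = bprod k fun b => f (M b)
  | 0, M => rfl
  | k + 1, M => by
    rw [bprod_succ, bprod_succ, map_mul, map_bprod f k, map_bprod f k]

/-- `Matrix.map` by a ring hom commutes with the ordered product `∏_b M_b` (layer-wise evaluation /
base change of the matrix form "`f(x) = (∏_i M_i(x_i))_{(0,0)}`").
[cite: ForbesShpilka2013, Lemma 3.1 = arXiv Lemma 6 (matrix form, evaluated layer-wise)] locator: paper:arxiv-1209.2408 p0013.txt:L5–L16 -/
theorem matrix_map_bprod {m : Type*} [Fintype m] [DecidableEq m] {R S : Type*}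
    [NonAssocSemiring R] [NonAssocSemiring S] (φ : R →+* S) (k : ℕ)
    (M : (Fin k → Fin 2) → Matrix m m R) :
    (bprod k M).map φ = bprod k fun b => (M b).map φ :=
  map_bprod (RingHom.mapMatrix φ : Matrix m m R →+* Matrix m m S) k M

/-- If all `M_b = 1` the ordered product is `1` ("padding the product with identity matrices in new
variables"). [cite: ForbesShpilka2013, arXiv Thm. 21, proof (padding with identity matrices)]
locator: paper:arxiv-1209.2408 p0017.txt:L9–L10 -/
theorem bprod_eq_one [MulOneClass A] : ∀ (k : ℕ) (M : (Fin k → Fin 2) → A),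
    (∀ b, M b = 1) → bprod k M = 1
  | 0, M, h => h _
  | k + 1, M, h => by
    rw [bprod_succ, bprod_eq_one k _ fun b => h _, bprod_eq_one k _ fun b => h _, one_mul]

/-- Over a ring without zero divisors a product of nonzero members is nonzero (width `1`: the
roABP "`(∏_i M_i(X_{σ(i)}))_{1,1}`" is then a plain product of univariates).
[cite: ForbesShpilkaVolk2018, §5.3 (definition of roABP), width-1 case] locator: paper:arxiv-1701.05328 p0019.txt:L79 -/
theorem bprod_ne_zero [MulZeroClass A] [NoZeroDivisors A] : ∀ (k : ℕ) (M : (Fin k → Fin 2) → A),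
    (∀ b, M b ≠ 0) → bprod k M ≠ 0
  | 0, M, h => h _
  | k + 1, M, h => by
    rw [bprod_succ]
    exact mul_ne_zero (bprod_ne_zero k _ fun b => h _) (bprod_ne_zero k _ fun b => h _)

/-- For `1 × 1` matrices the `(0,0)` entry is multiplicative, so the entry of the ordered product is
the ordered product of the entries (width-`1` roABPs "`(∏_i M_i(X_{σ(i)}))_{1,1}`" are products of
univariates). [cite: ForbesShpilkaVolk2018, §5.3 (definition of roABP), width-1 case] locator: paper:arxiv-1701.05328 p0019.txt:L79 -/
theorem bprod_apply_fin_one {R : Type*} [NonUnitalNonAssocSemiring R] :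
    ∀ (k : ℕ) (M : (Fin k → Fin 2) → Matrix (Fin 1) (Fin 1) R),
      bprod k M 0 0 = bprod k fun b => M b 0 0
  | 0, M => rfl
  | k + 1, M => by
    rw [bprod_succ, bprod_succ, Matrix.mul_apply, Fin.sum_univ_one, bprod_apply_fin_one k,
      bprod_apply_fin_one k]

/-! ### Degree bound for products of matrices of univariate polynomials -/

section Degree

variable {R : Type*} [CommSemiring R] {w : ℕ}

/-- Entries of a product of two matrices of univariate polynomials of degrees `≤ D₁`, `≤ D₂` have
degree `≤ D₁ + D₂` (the degree count "`R(x) := ∏_i M_i(f_i(x))` … is of degree `< Dnm`").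
[cite: ForbesShpilka2013, Lemma 3.6 = arXiv Lemma 12, proof (degree count)] locator: paper:arxiv-1209.2408 p0014.txt:L29 -/
theorem natDegree_mul_le_of_le {M N : Matrix (Fin w) (Fin w) R[X]} {D₁ D₂ : ℕ}
    (hM : ∀ i j, (M i j).natDegree ≤ D₁) (hN : ∀ i j, (N i j).natDegree ≤ D₂) (i j : Fin w) :
    ((M * N) i j).natDegree ≤ D₁ + D₂ := by
  rw [Matrix.mul_apply]
  refine Polynomial.natDegree_sum_le_of_forall_le _ _ fun l _ => ?_
  exact (Polynomial.natDegree_mul_le).trans (Nat.add_le_add (hM i l) (hN l j))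

/-- **Degree count of Lemma 3.6 / arXiv Lemma 12 ("`R(x) := ∏_i M_i(f_i(x))` … is of degree `< Dnm`"):**
the entries of the `2ᵏ`-fold ordered product of `w × w` matrices of univariate polynomials of degree
`≤ D` have degree `≤ 2ᵏ · D`. [cite: ForbesShpilka2013, Lemma 3.6 = arXiv Lemma 12, proof]
locator: paper:arxiv-1209.2408 p0014.txt:L29 -/
theorem natDegree_bprod_le : ∀ (k : ℕ) (M : (Fin k → Fin 2) → Matrix (Fin w) (Fin w) R[X]) {D : ℕ},
    (∀ b i j, (M b i j).natDegree ≤ D) → ∀ i j, (bprod k M i j).natDegree ≤ 2 ^ k * D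
  | 0, M, D, h, i, j => by simpa using h _ i j
  | k + 1, M, D, h, i, j => by
    have h2 : 2 ^ (k + 1) * D = 2 ^ k * D + 2 ^ k * D := by ring
    rw [bprod_succ, h2]
    exact natDegree_mul_le_of_le (natDegree_bprod_le k _ fun b => h _)
      (natDegree_bprod_le k _ fun b => h _) i j

end Degree

/-! ### The bridge to the roABP layer order `binaryOrder n = finFunctionFinEquiv.symm ∘ …` -/

section Bridge

/-- The bit vector of an index `j < 2ᵏ` (read in `Fin (2^(k+1))`) is the bit vector of `j` with top bit
`0` ("the canonical identification of a multilinear monomial with an index in `[N]`, say, using the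
binary representation"). [cite: ForbesShpilkaVolk2018, §7.1 (binary representation of the index)]
locator: paper:arxiv-1701.05328 chunk p0024.txt:L1 -/
theorem finFunctionFinEquiv_symm_of_val_eq {k : ℕ} (i : Fin (2 ^ k)) (j : Fin (2 ^ (k + 1)))
    (hj : (j : ℕ) = i) :
    (finFunctionFinEquiv.symm j : Fin (k + 1) → Fin 2) = Fin.snoc (finFunctionFinEquiv.symm i) 0 := by
  ext b
  rw [finFunctionFinEquiv_symm_apply_val, hj]
  refine Fin.lastCases ?_ (fun b => ?_) b
  · rw [Fin.snoc_last, Fin.val_last, Fin.val_zero, Nat.div_eq_of_lt i.is_lt, Nat.zero_mod]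
  · rw [Fin.snoc_castSucc, Fin.val_castSucc, finFunctionFinEquiv_symm_apply_val]

/-- The bit vector of the index `2ᵏ + j` (`j < 2ᵏ`) is the bit vector of `j` with top bit `1`
("using the binary representation"). [cite: ForbesShpilkaVolk2018, §7.1 (binary representation of the index)]
locator: paper:arxiv-1701.05328 chunk p0024.txt:L1 -/
theorem finFunctionFinEquiv_symm_of_val_eq_add {k : ℕ} (i : Fin (2 ^ k)) (j : Fin (2 ^ (k + 1)))
    (hj : (j : ℕ) = 2 ^ k + i) :
    (finFunctionFinEquiv.symm j : Fin (k + 1) → Fin 2) = Fin.snoc (finFunctionFinEquiv.symm i) 1 := by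
  ext b
  rw [finFunctionFinEquiv_symm_apply_val, hj]
  refine Fin.lastCases ?_ (fun b => ?_) b
  · rw [Fin.snoc_last, Fin.val_last, Fin.val_one, Nat.add_div_of_dvd_right (dvd_refl _),
      Nat.div_self (Nat.two_pow_pos k), Nat.div_eq_of_lt i.is_lt]
  · have hb : (b : ℕ) < k := b.is_lt
    rw [Fin.snoc_castSucc, Fin.val_castSucc, finFunctionFinEquiv_symm_apply_val,
      Nat.add_div_of_dvd_right (Nat.pow_dvd_pow 2 hb.le), Nat.pow_div hb.le (by norm_num)]
    obtain ⟨c, hc⟩ : ∃ c, k - (b : ℕ) = c + 1 := ⟨k - b - 1, by omega⟩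
    rw [hc, pow_succ, Nat.add_comm, Nat.add_mul_mod_self_right]

/-- **The roABP layer product in the binary order is `bprod`:** for a monoid-valued family on the bit
vectors, `(List.ofFn fun j : Fin (2^k) => M (bits of j)).prod = ∏_{b ∈ {0,1}^k} M_b` (little-endian,
`j = Σ_i b_i 2^i`; the first `2^k` indices of `Fin (2^(k+1))` are the bit vectors with top bit `0`).
This identifies the cell's `IsROABP … (binaryOrder n) …` products with the recursion
"`𝒮 = 𝒮_0 · 𝒮_1`" of [FS13]. [cite: ForbesShpilka2013, arXiv Lemma 19, proof; ForbesShpilkaVolk2018, §7.1 ("binary representation")]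
locator: paper:arxiv-1209.2408 p0016.txt:L37; paper:arxiv-1701.05328 chunk p0024.txt:L1 -/
theorem prod_ofFn_finFunctionFinEquiv_symm [Monoid A] :
    ∀ (k : ℕ) (M : (Fin k → Fin 2) → A),
      (List.ofFn fun j : Fin (2 ^ k) => M (finFunctionFinEquiv.symm j)).prod = bprod k M
  | 0, M => by
    change (List.ofFn fun j : Fin (0 + 1) => M (finFunctionFinEquiv.symm j)).prod = _
    rw [bprod_zero, List.ofFn_succ, List.ofFn_zero, List.prod_cons, List.prod_nil, mul_one,
      eq_elim0 (finFunctionFinEquiv.symm 0)]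
  | k + 1, M => by
    have h : 2 ^ k + 2 ^ k = 2 ^ (k + 1) := by rw [pow_succ, mul_two]
    have h0 : (fun i : Fin (2 ^ k) =>
        M (finFunctionFinEquiv.symm (Fin.cast h.symm.symm (Fin.castLE (Nat.le_add_right _ _) i)))) =
        fun i => M (Fin.snoc (finFunctionFinEquiv.symm i) 0) := funext fun i => by
      rw [finFunctionFinEquiv_symm_of_val_eq i _ (by simp)]
    have h1 : (fun i : Fin (2 ^ k) =>
        M (finFunctionFinEquiv.symm (Fin.cast h.symm.symm (Fin.natAdd (2 ^ k) i)))) =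
        fun i => M (Fin.snoc (finFunctionFinEquiv.symm i) 1) := funext fun i => by
      rw [finFunctionFinEquiv_symm_of_val_eq_add i _ (by simp [Nat.add_comm])]
    rw [bprod_succ, ← prod_ofFn_finFunctionFinEquiv_symm k, ← prod_ofFn_finFunctionFinEquiv_symm k,
      ← List.prod_append, List.ofFn_congr h.symm, List.ofFn_add, h0, h1]

end Bridge

/-! ### Evaluation families and their two halves -/

section Halves

variable {X : Type*}

/-- Splitting an assignment on `{0,1}^{k+1}` into its two halves along the top bit, and back (the two
variable-disjoint halves of "`𝒮 = 𝒮_0 · 𝒮_1`"). [cite: ForbesShpilka2013, arXiv Lemma 19, proof ("`𝒮 = 𝒮_0 · 𝒮_1`")]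
locator: paper:arxiv-1209.2408 p0016.txt:L37 -/
def splitTop (k : ℕ) : ((Fin (k + 1) → Fin 2) → X) ≃ ((Fin k → Fin 2) → X) × ((Fin k → Fin 2) → X) where
  toFun x := (fun b => x (Fin.snoc b 0), fun b => x (Fin.snoc b 1))
  invFun p := fun b => if b (Fin.last k) = 0 then p.1 (Fin.init b) else p.2 (Fin.init b)
  left_inv x := by
    funext b
    by_cases hb : b (Fin.last k) = 0
    · simp only [hb, if_true]
      rw [← hb, Fin.snoc_init_self]
    · simp only [hb, if_false]
      have hb1 : b (Fin.last k) = 1 := by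
        rcases Fin.exists_fin_two.mp ⟨b (Fin.last k), rfl⟩ with h | h
        · exact absurd h hb
        · exact h
      rw [← hb1, Fin.snoc_init_self]
  right_inv p := by
    ext b <;> simp [Fin.snoc_last, Fin.init_snoc]

/-- The `0`-half of a split assignment. [cite: ForbesShpilka2013, arXiv Lemma 19, proof ("`𝒮_0`")]
locator: paper:arxiv-1209.2408 p0016.txt:L33 -/
@[simp] theorem splitTop_apply_fst (k : ℕ) (x : (Fin (k + 1) → Fin 2) → X) (b : Fin k → Fin 2) :
    (splitTop k x).1 b = x (Fin.snoc b 0) := rfl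

/-- The `1`-half of a split assignment. [cite: ForbesShpilka2013, arXiv Lemma 19, proof ("`𝒮_1`")]
locator: paper:arxiv-1209.2408 p0016.txt:L33 -/
@[simp] theorem splitTop_apply_snd (k : ℕ) (x : (Fin (k + 1) → Fin 2) → X) (b : Fin k → Fin 2) :
    (splitTop k x).2 b = x (Fin.snoc b 1) := rfl

/-- **"`𝒮 = 𝒮_0 · 𝒮_1`" at the level of the generating sets:** the set of ordered products
`∏_{b ∈ {0,1}^{k+1}} Φ_b(x_b)` over all assignments `x` is the pointwise product of the two sets of
half-products over independent assignments (the halves read disjoint variables).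
[cite: ForbesShpilka2013, arXiv Lemma 19, proof ("It follows from definition that `𝒮 = 𝒮_0 · 𝒮_1`")]
locator: paper:arxiv-1209.2408 p0016.txt:L37 -/
theorem range_bprod_succ_eq_mul [Mul A] (k : ℕ) (Φ : (Fin (k + 1) → Fin 2) → X → A) :
    Set.range (fun x : (Fin (k + 1) → Fin 2) → X => bprod (k + 1) fun b => Φ b (x b)) =
      Set.range (fun x : (Fin k → Fin 2) → X => bprod k fun b => Φ (Fin.snoc b 0) (x b)) *
        Set.range (fun x : (Fin k → Fin 2) → X => bprod k fun b => Φ (Fin.snoc b 1) (x b)) := by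
  ext P
  simp only [Set.mem_range, Set.mem_mul]
  constructor
  · rintro ⟨x, rfl⟩
    exact ⟨_, ⟨(splitTop k x).1, rfl⟩, _, ⟨(splitTop k x).2, rfl⟩, by rw [bprod_succ]; rfl⟩
  · rintro ⟨_, ⟨x₀, rfl⟩, _, ⟨x₁, rfl⟩, rfl⟩
    refine ⟨(splitTop k).symm (x₀, x₁), ?_⟩
    have h0 : ∀ b, (splitTop k).symm (x₀, x₁) (Fin.snoc b 0) = x₀ b := fun b =>
      congrFun (congrArg Prod.fst ((splitTop k).apply_symm_apply (x₀, x₁))) b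
    have h1 : ∀ b, (splitTop k).symm (x₀, x₁) (Fin.snoc b 1) = x₁ b := fun b =>
      congrFun (congrArg Prod.snd ((splitTop k).apply_symm_apply (x₀, x₁))) b
    rw [bprod_succ]
    congr 1
    · exact bprod_congr fun b => by rw [h0]
    · exact bprod_congr fun b => by rw [h1]

end Halves

end FS2013

end Literature.Computability.AlgebraicComplexity
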